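import Mathlib.Analysis.Fourier.ZMod
import Mathlib.Analysis.SpecialFunctions.Complex.CircleAddChar
import Mathlib.Analysis.SpecialFunctions.Trigonometric.Basic
import Mathlib.Data.ZMod.Basic
import Literature.Probability.LatticeModels.LatticeGraph
import Literature.Probability.LatticeModels.Correlations
import HarnessLib

-- provenance: harness21/H21/H21/Prelude/StatMech/TorusFourier.lean @ 6de89a0 (interim HEAD d8f2665); M5 mechanical rewrite
/-!
# Discrete Fourier transform on the torus `(ℤ/Lℤ)^d` and the lattice dispersion

Trunk G02 (T-STATMECH), prelude item P10 (notion `discrete_fourier_torus`).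

We set up the `d`-dimensional discrete Fourier transform on the discrete torus
`TorusSite d L = Fin d → ZMod L`, the lattice momenta `p_i = 2π k_i / L`, the free lattice
dispersion `∑ i, (1 - cos p_i)` (half the Fourier symbol of minus the lattice Laplacian), and the
Fourier transform `Ĝ_L(k)` of the spin two-point function of a measure on spin configurations on
the torus (Friedli–Velenik, *Statistical Mechanics of Lattice Systems* (2017), §10.4, eq. (10.36);
Fernández–Fröhlich–Sokal, *Random Walks, Critical Phenomena, and Triviality* (1992), §1.2).

## Mathlib anchors and design choices

* Mathlib has the one-dimensional discrete Fourier transform `ZMod.dft` (notation `𝓕`,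
  `Mathlib/Analysis/Fourier/ZMod.lean`) with `ZMod.dft_apply : 𝓕 Φ k = ∑ j, stdAddChar (-(j * k)) • Φ j`,
  i.e. the kernel `e^{-2πi jk/N}` (MINUS sign). Mathlib has no `d`-dimensional version on
  `Fin d → ZMod L`; `torusFourier` below is the product-character analogue with the SAME sign
  convention, and `torusFourier_one_eq_dft` is the `d = 1` bridge along
  `Equiv.funUnique (Fin 1) (ZMod L)`.
* The character is Mathlib's `ZMod.stdAddChar : AddChar (ZMod N) ℂ`
  (`stdAddChar j = exp (2π I j / N)`, via `ZMod.toCircle`).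
* For even functions `f (-x) = f x` (e.g. two-point functions of reflection-symmetric measures)
  the sign convention is immaterial and the transform is real; see
  `twoPointFourierTorus_im_eq_zero`.
* `twoPointFourierTorus` is the *unnormalised* sum `∑_x G_L(0,x) e^{-i k·x}` as in
  Friedli–Velenik (10.36); no `1/L^d` or `1/√(L^d)` factor.
* Two-point functions are expectations of products (`spinTwoPoint`, outline §0), so
  `torusTwoPoint μ 0 = 1` for a probability measure.
-/

noncomputable section

open MeasureTheory Finset ZMod

namespace Literature.Probability.LatticeModels

variable {d L : ℕ}

/-! ### The discrete Fourier transform on `(ℤ/Lℤ)^d` -/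

/-- The discrete Fourier transform on the torus `(ℤ/Lℤ)^d`:
`torusFourier f k = ∑ x, f x * ∏ i, e^{-2πi k_i x_i / L}`, with Mathlib's (`ZMod.dft`) minus-sign
convention. For even `f` the sign is immaterial. Unnormalised (no `1/L^d`).
(Friedli–Velenik 2017, §10.4; Mathlib `ZMod.dft_apply` for `d = 1`.) [cite: FriedliVelenik2017, §10.4] -/
def torusFourier [NeZero L] (f : TorusSite d L → ℂ) (k : TorusSite d L) : ℂ :=
  ∑ x : TorusSite d L, f x * ∏ i, stdAddChar (-(k i * x i))

/-- The inverse discrete Fourier transform on `(ℤ/Lℤ)^d`: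
`torusFourierInv g x = (L^d)⁻¹ * ∑ k, g k * ∏ i, e^{+2πi k_i x_i / L}`
(matches Mathlib `ZMod.invDFT_apply` for `d = 1`; Friedli–Velenik 2017, §10.4). [cite: FriedliVelenik2017, §10.4] -/
def torusFourierInv [NeZero L] (g : TorusSite d L → ℂ) (x : TorusSite d L) : ℂ :=
  ((L : ℂ) ^ d)⁻¹ * ∑ k : TorusSite d L, g k * ∏ i, stdAddChar (k i * x i)

/-- For `d = 1`, `torusFourier` is Mathlib's `ZMod.dft` transported along
`Equiv.funUnique (Fin 1) (ZMod L) : (Fin 1 → ZMod L) ≃ ZMod L`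
(Mathlib `ZMod.dft_apply`). [folklore] -/
def torusFourier_one_eq_dft : Prop :=
  ∀ [NeZero L] (f : TorusSite 1 L → ℂ) (k : TorusSite 1 L),
    torusFourier f k =
      𝓕 (f ∘ (Equiv.funUnique (Fin 1) (ZMod L)).symm) (Equiv.funUnique (Fin 1) (ZMod L) k)

/-- The Fourier transform at `k = 0` is the plain sum `∑ x, f x`
(cf. Mathlib `ZMod.dft_apply_zero`). [folklore] -/
theorem torusFourier_apply_zero [NeZero L] (f : TorusSite d L → ℂ) :
    torusFourier f 0 = ∑ x, f x := by
  simp [torusFourier]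

/-- Fourier inversion on `(ℤ/Lℤ)^d`: `torusFourierInv (torusFourier f) = f`
(Mathlib `ZMod.dft_dft` / `LinearEquiv.symm_apply_apply` for `d = 1`;
Friedli–Velenik 2017, §10.4). [cite: FriedliVelenik2017, §10.4] -/
def torusFourier_inversion : Prop :=
  ∀ [NeZero L] (f : TorusSite d L → ℂ),
    torusFourierInv (torusFourier f) = f

/-- The other inversion identity: `torusFourier (torusFourierInv g) = g`
(Mathlib `LinearEquiv.apply_symm_apply` for `ZMod.dft`, `d = 1`). [folklore] -/
def torusFourier_torusFourierInv : Prop :=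
  ∀ [NeZero L] (g : TorusSite d L → ℂ),
    torusFourier (torusFourierInv g) = g

/-- Plancherel/Parseval on `(ℤ/Lℤ)^d` for the unnormalised transform:
`∑ k, ‖f̂ k‖² = L^d * ∑ x, ‖f x‖²` (Friedli–Velenik 2017, §10.4; Stein–Shakarchi,
*Fourier Analysis*, Ch. 7, Thm 1.2 for `d = 1`). [cite: FriedliVelenik2017, §10.4] -/
def torusFourier_plancherel : Prop :=
  ∀ [NeZero L] (f : TorusSite d L → ℂ),
    ∑ k, ‖torusFourier f k‖ ^ 2 = (L : ℝ) ^ d * ∑ x, ‖f x‖ ^ 2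

/-! ### Lattice momenta and the free dispersion relation -/

/-- The lattice momentum attached to `k ∈ (ℤ/Lℤ)^d`: `p_i = 2π k_i / L ∈ [0, 2π)`, using the
representative `(k i).val ∈ {0, …, L-1}` (Friedli–Velenik 2017, §10.4; Fernández–Fröhlich–Sokal
1992, §1.2). For `L = 0` this is the junk value `0` (division by zero). [cite: FriedliVelenik2017, §10.4] -/
def latticeMomentum (L : ℕ) (k : TorusSite d L) : Fin d → ℝ :=
  fun i => 2 * Real.pi * ((k i).val : ℝ) / L

/-- The free lattice dispersion `ε(p) = ∑ i, (1 - cos p_i)`, i.e. half the Fourier symbol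
`2 ∑ i (1 - cos p_i)` of `-Δ` on `ℤ^d` (Fernández–Fröhlich–Sokal 1992, §1.2, eq. (1.20);
Friedli–Velenik 2017, §8.4). [cite: FernandezFrohlichSokal1992, §1.2  eq. (1.20] -/
def dispersion (p : Fin d → ℝ) : ℝ :=
  ∑ i, (1 - Real.cos (p i))

/-- The dispersion is nonnegative since `cos ≤ 1`. [folklore] -/
theorem dispersion_nonneg (p : Fin d → ℝ) : 0 ≤ dispersion p :=
  Finset.sum_nonneg fun i _ => sub_nonneg.mpr (Real.cos_le_one (p i))

/-- The dispersion vanishes exactly at momenta in `(2πℤ)^d`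
(each `cos p_i = 1`, Mathlib `Real.cos_eq_one_iff`). [folklore] -/
def dispersion_eq_zero_iff : Prop :=
  ∀ (p : Fin d → ℝ),
    dispersion p = 0 ↔ ∀ i, ∃ n : ℤ, (n : ℝ) * (2 * Real.pi) = p i

/-- On lattice momenta the dispersion vanishes only at `k = 0`
(for `0 < L`; Friedli–Velenik 2017, §10.4). [cite: FriedliVelenik2017, §10.4] -/
def dispersion_latticeMomentum_eq_zero_iff : Prop :=
  ∀ [NeZero L] (k : TorusSite d L),
    dispersion (latticeMomentum L k) = 0 ↔ k = 0

/-! ### Two-point functions on the torus and their Fourier transform -/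

/-- The two-point function `G_L(x) = ⟨σ_0 σ_x⟩_μ` of a measure `μ` on spin configurations on the
torus `(ℤ/Lℤ)^d`, as the expectation of the product `σ_0 σ_x` (so `G_L(0) = 1` for a probability
measure). (Friedli–Velenik 2017, §3.2 eq. (3.19) and §10.4.) [cite: FriedliVelenik2017, §3.2 eq. (3.19] -/
def torusTwoPoint (μ : Measure (SpinConfig (TorusSite d L))) (x : TorusSite d L) : ℝ :=
  spinTwoPoint μ 0 x

/-- `G_L(0) = ⟨σ_0 σ_0⟩ = 1` for a probability measure. [folklore] -/
@[simp] theorem torusTwoPoint_zero (μ : Measure (SpinConfig (TorusSite d L)))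
    [IsProbabilityMeasure μ] : torusTwoPoint μ 0 = 1 :=
  spinTwoPoint_self μ 0

/-- The Fourier transform of the torus two-point function,
`Ĝ_L(k) = ∑_x G_L(x) e^{-i p·x}` with `p = latticeMomentum L k` — the *unnormalised* sum of
Friedli–Velenik 2017, eq. (10.36) (no `1/L^d` factor), with Mathlib's minus-sign convention
(immaterial when `G_L` is even). [cite: FriedliVelenik2017, eq. (10.36] -/
def twoPointFourierTorus [NeZero L] (μ : Measure (SpinConfig (TorusSite d L)))
    (k : TorusSite d L) : ℂ :=
  torusFourier (fun x => (torusTwoPoint μ x : ℂ)) k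

/-- `Ĝ_L(0) = ∑_x G_L(x)` (the finite-volume susceptibility when `⟨σ⟩ = 0`;
Friedli–Velenik 2017, §10.4). [cite: FriedliVelenik2017, §10.4] -/
theorem twoPointFourierTorus_zero [NeZero L] (μ : Measure (SpinConfig (TorusSite d L))) :
    twoPointFourierTorus μ 0 = ∑ x, (torusTwoPoint μ x : ℂ) := by
  simp [twoPointFourierTorus, torusFourier_apply_zero]

/-- If `μ` is invariant under the reflection `x ↦ -x` of the torus (push-forward of `μ` under
`σ ↦ σ ∘ Neg.neg` is `μ`), then `G_L` is even and `Ĝ_L(k)` is real: its imaginary part vanishes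
(Friedli–Velenik 2017, §10.4, discussion after (10.36)). [cite: FriedliVelenik2017, §10.4  discussion after (10.36] -/
def twoPointFourierTorus_im_eq_zero : Prop :=
  ∀ [NeZero L] (μ : Measure (SpinConfig (TorusSite d L))) (hμ : μ.map (fun σ : SpinConfig (TorusSite d L) => fun x => σ (-x)) = μ) (k : TorusSite d L),
    (twoPointFourierTorus μ k).im = 0

end Literature.Probability.LatticeModels
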